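import Mathlib.Analysis.SpecialFunctions.Complex.Log
import Mathlib.Analysis.Complex.Polynomial.Basic
import Mathlib.LinearAlgebra.Basis.VectorSpace
import Mathlib.NumberTheory.Transcendental.Liouville.LiouvilleNumber
import Mathlib.RingTheory.Localization.Integral
import Literature.Barriers.Schanuel.AxiomsDoNotForceSchanuel
import Literature.NumberTheory.Transcendental.PseudoExpVariants
import Literature.NumberTheory.Transcendental.PlaneCurveTranscendence
import Literature.NumberTheory.Transcendental.ZilberFieldCCP
import HarnessLib

/-!
# Bays–Kirby's fields `𝔹_P`: the §9.2 base inside `ℂ`, and the reduction of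
`baysKirby2018_modelsWithoutSchanuel` to the construction of a model over that base (proof file)

Sibling proof file of `Literature/Barriers/Schanuel/AxiomsDoNotForceSchanuel.lean` for the named
fact `Literature.Barriers.Schanuel.baysKirby2018_modelsWithoutSchanuel` (M. Bays, J. Kirby,
*Pseudo-exponential maps, variants, and quasiminimality*, Algebra & Number Theory 12 (2018)
493–549, arXiv:1512.04262v4, §9.2 with Thm 1.7 / Thm 8.2 / Thm 9.1: for every admissible
`P ∈ ℤ[x, y]` a quasiminimal exponential field `𝔹_P` of cardinality `𝔠` with axioms 1, 2, 4, 5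
and `P(exp 1, τ) = 0`).

The printed proof (§9.2, p. 28) has two parts; this file PROVES the first and the assembly, and
states the second — the body of the paper — as an explicit hypothesis of the assembly:

1. **The base.** "choose an irreducible polynomial `P(x, y) ∈ ℤ[x, y]` and take `(ε, τ)` to be
   a generic zero … take `K` to be the field `ℚ^{ab}(τ, (ε_m)_{m ∈ ℕ⁺})`, and define `Γ(K)` to be
   the graph of a homomorphism from the `ℚ`-linear span of `τ` and `1`, with `τ/m ↦ ω_m` … and
   `1/m ↦ ε_m`" — a finitely generated partial exponential field with standard kernel
   (`Literature.NumberTheory.Transcendental.IsStdKernelPartialExpField`, `PseudoExpVariants.lean`: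
   Def. 3.8, Def. 3.15, Thm 9.1 (2)). Here: `τ ∈ ℂ` transcendental (Liouville's constant), `ε` a
   root of `P(x, τ)` (it exists since `deg_x P > 0`, and is transcendental since `P` is
   irreducible with `deg_y P > 0`: `PlaneCurveTranscendence.lean`), `θ = exp ∘ g` for a `ℚ`-linear
   `g` with `g 1 = log ε`, `g τ = 2πi`, and `K = ℚ(D ∪ θ D) ⊆ ℂ`, `D = span_ℚ(1, τ)`:
   `exists_isStdKernelPartialExpField`, `exists_base_of_isAdmissibleRelation` (PROVED).
2. **The construction** (NOT formalised; the hypothesis `h` of part 3). "Now the construction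
   gives us a canonical model `𝔹_P`, the unique model of cardinality continuum of almost the same
   list of axioms as those for `𝔹`"; "More generally, we can take any finitely generated partial
   exponential field with standard kernel … as `F_base` and do the same construction to build a
   quasiminimal exponential field `𝕄(F_base)` of size continuum" (§9.2) — i.e. Thm 1.7 (the model
   of cardinality continuum of the quasiminimal class `𝒦(M(F_base))`, Fact 6.4, quasiminimal)
   with Thm 8.2 (its axioms: 1 full Γ-field = ELA; 2 base and kernels; 3 `F_base ◁ F`; 4 strong
   exponential-algebraic closedness over `Γ(F_base) ∪ a`, which contains Kirby's scheme
   `IsLinIndepExpAlgClosed`, cf. `isLinIndepExpAlgClosed_of_closed_over_base`; 5 the countable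
   closure property). What the assembly USES of this, and therefore what `h` states, is: over
   every such base `(K, D, θ, τ)` there are an exponential field `F` and a field embedding
   `ι : K →+* F` with `F` a *soft Zilber field* (`IsSoftZilberField F`: `#F = 𝔠`, ELA, standard
   kernel, Kirby's scheme, CCP, quasiminimal — axioms 1, 2, 4, 5 of Thm 9.1) extending the base
   (`exp (ι x) = ι (θ x)` on `D`) with the base's kernel (`ker exp = ι(τ)ℤ`). Its proof is §§3–8
   of the paper (Kummer theory for good bases, Prop. 3.22; full closures, §4; amalgamation,
   Thm 5.9; the quasiminimal pregeometry structure `M(F_base)`, Thm 6.9; the axiomatisation,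
   Thm 8.2) together with Bays–Hart–Hyttinen–Kesälä–Kirby 2014, Thm 2.3 (= Fact 6.4) and
   Kirby 2010 (`ecl ⊆ Γcl`) — a theory, not a lemma; under the fact-decomposition discipline
   (D-0026) it is carried here as a hypothesis and NOT vendored as a further named fact (the
   named fact of this barrier is `baysKirby2018_modelsWithoutSchanuel` itself; review of
   2026-08-15, which merged the former stand-alone fact
   `baysKirby2018_modelOverPartialExpField` back into this proof obligation).
3. **Assembly** (`baysKirby2018_modelsWithoutSchanuel_of_softModels`, PROVED): given `h`, the
   model `F` over the base of part 1 has `#F = 𝔠`, is an ELA-field, `ker exp = ι(τ)ℤ` with `ι τ`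
   transcendental, `exp 1 = exp (ι 1) = ι (θ 1) = ι ε` transcendental with
   `P(exp 1, ι τ) = ι(P(ε, τ)) = 0`, satisfies Kirby's scheme, the countable closure property and
   is quasiminimal — i.e. it witnesses `baysKirby2018_modelsWithoutSchanuel P`. Consequently the
   existence of the counter-models and the refutation of the soft technique class follow from the
   construction over standard-kernel bases alone (`not_softDerivationOfSchanuel_of_softModels`,
   `axiomsDoNotForceSchanuel_of_softModels`; both statements are spelled out, so that they do not
   depend on the body of the catalogue declaration `AxiomsDoNotForceSchanuel`).

Trust base after this file: `baysKirby2018_modelsWithoutSchanuel` (and `¬ SoftDerivationOfSchanuel`)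
⇐ "a soft Zilber field with the base's kernel over every finitely generated partial exponential
field with standard kernel" (Bays–Kirby Thm 1.7 / Thm 8.2 / §9.2; hypothesis `h`, no Lean name).

## References

* M. Bays, J. Kirby, *Pseudo-exponential maps, variants, and quasiminimality*, Algebra & Number
  Theory 12 (2018) 493–549, arXiv:1512.04262v4: Thm 1.7 (p. 4), Def. 3.8, Def. 3.15, Fact 6.4,
  Thm 6.9, Thm 8.2 (p. 26), Thm 9.1, §9.2 (p. 28), Remark 10.10.
* M. Bays, B. Hart, T. Hyttinen, M. Kesälä, J. Kirby, *Quasiminimal structures and excellence*,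
  Bull. LMS 46 (2014) 155–163, Thm 2.3.
-/

noncomputable section

open Cardinal FirstOrder
open Literature.ModelTheory.ExponentialFields Literature.ModelTheory.ExponentialFields.ExponentialRing
open Literature.NumberTheory.Transcendental

namespace Literature.Barriers.Schanuel

/-! ### The §9.2 base inside `ℂ`

Bays–Kirby §9.2: "choose an irreducible polynomial `P(x, y) ∈ ℤ[x, y]` and take `(ε, τ)` to be a
generic zero of the polynomial `P(x, y)` … Choose a division sequence `(ε_m)` for `ε` … take `K`
to be the field `ℚ^{ab}(τ, (ε_m)_{m ∈ ℕ⁺})`, and define `Γ(K)` to be the graph of a homomorphism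
from the `ℚ`-linear span of `τ` and `1`, with `τ/m ↦ ω_m` as above and `1/m ↦ ε_m`." Inside `ℂ`
all choices are made at once by `θ = exp ∘ g` for a `ℚ`-linear `g : ℂ → ℂ` with `g 1 = log ε`
and `g τ = 2πi`: then `θ(1/m) = exp((log ε)/m)` is a division sequence of `ε` and
`θ(τ/m) = e^{2πi/m} = ω_m`. -/

/-- A `ℚ`-linear map `g : ℂ → ℂ` with `g 1 = L` and `g τ = 2πi`, for `τ` transcendental (so that
`1, τ` are `ℚ`-linearly independent and extend to a `ℚ`-basis of `ℂ`). [folklore] -/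
theorem exists_linearMap_apply_one_apply_tau {τ : ℂ} (hτ : Transcendental ℚ τ) (L : ℂ) :
    ∃ g : ℂ →ₗ[ℚ] ℂ, g 1 = L ∧ g τ = 2 * Real.pi * Complex.I := by
  classical
  have hv : LinearIndependent ℚ ![(1 : ℂ), τ] :=
    Literature.Barriers.Schanuel.linearIndependent_one_tau hτ
  have hs : LinearIndepOn ℚ id (Set.range ![(1 : ℂ), τ]) := hv.linearIndepOn_id
  have hsub : Set.range ![(1 : ℂ), τ] ⊆ hs.extend (Set.subset_univ _) := hs.subset_extend _
  have h1 : (1 : ℂ) ∈ hs.extend (Set.subset_univ _) := hsub ⟨0, rfl⟩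
  have hτm : τ ∈ hs.extend (Set.subset_univ _) := hsub ⟨1, rfl⟩
  have hτ1 : τ ≠ 1 := fun h => hτ (h ▸ isAlgebraic_one)
  let φ : ℂ → ℂ := fun c => if c = τ then 2 * Real.pi * Complex.I else L
  refine ⟨(Module.Basis.extend hs).constr ℚ (fun x => φ x), ?_, ?_⟩
  · have h := Module.Basis.constr_basis (Module.Basis.extend hs) ℚ (fun x => φ x) ⟨1, h1⟩
    rw [Module.Basis.extend_apply_self] at h
    exact h.trans (by simp [φ, hτ1.symm])
  · have h := Module.Basis.constr_basis (Module.Basis.extend hs) ℚ (fun x => φ x) ⟨τ, hτm⟩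
    rw [Module.Basis.extend_apply_self] at h
    exact h.trans (by simp [φ])

/-- **The kernel of `θ = exp ∘ g` on `D = span_ℚ(1, τ)` is exactly `τℤ`** when
`Complex.exp (g 1) = ε` is transcendental and `g τ = 2πi`: if `θ(a + cτ) = 1` with `a ≠ 0` then
`g 1 ∈ ℚ · 2πi`, so `ε` would be a root of unity; and `θ(cτ) = e^{2πi c} = 1` iff `c ∈ ℤ`. This is
the "standard kernel" of the §9.2 base (it uses that `ε` is not a root of unity).
[cite: BaysKirby2018ANT, §9.2] -/
theorem exp_linearMap_eq_one_iff {τ ε : ℂ} (hε : Transcendental ℚ ε)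
    {g : ℂ →ₗ[ℚ] ℂ} (hg1 : Complex.exp (g 1) = ε) (hgτ : g τ = 2 * Real.pi * Complex.I)
    {z : ℂ} (hz : z ∈ Submodule.span ℚ ({1, τ} : Set ℂ)) :
    Complex.exp (g z) = 1 ↔ z ∈ AddSubgroup.zmultiples τ := by
  constructor
  · intro h1
    obtain ⟨n, hn⟩ := Complex.exp_eq_one_iff.mp h1
    obtain ⟨a, c, rfl⟩ := Submodule.mem_span_pair.mp hz
    rw [map_add, map_smul, map_smul, hgτ] at hn
    by_cases ha : a = 0
    · subst ha
      rw [zero_smul, zero_add, Rat.smul_def] at hn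
      have hc : (c : ℂ) = n := mul_right_cancel₀ Complex.two_pi_I_ne_zero hn
      have hc' : c = n := by exact_mod_cast hc
      rw [zero_smul, zero_add, hc', Int.cast_smul_eq_zsmul]
      exact ⟨n, rfl⟩
    · exfalso
      apply hε
      -- `g 1 = q • 2πi` with `q = (n - c)/a`, so `ε ^ q.den = 1`
      set q : ℚ := (n - c) / a with hq
      have hL : g 1 = (q : ℂ) * (2 * Real.pi * Complex.I) := by
        rw [Rat.smul_def, Rat.smul_def] at hn
        have ha' : (a : ℂ) ≠ 0 := by exact_mod_cast ha
        rw [hq]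
        push_cast
        field_simp
        linear_combination hn
      have hpow : ε ^ q.den = 1 := by
        rw [← hg1, ← Complex.exp_nat_mul, hL, ← mul_assoc]
        have : ((q.den : ℕ) : ℂ) * (q : ℂ) = (q.num : ℂ) := by
          rw [mul_comm]
          exact_mod_cast Rat.mul_den_eq_num q
        rw [this]
        exact Complex.exp_int_mul_two_pi_mul_I q.num
      exact IsAlgebraic.of_pow q.den_pos (hpow ▸ isAlgebraic_one)
  · rintro ⟨n, rfl⟩
    rw [map_zsmul, hgτ, zsmul_eq_mul]
    exact Complex.exp_int_mul_two_pi_mul_I n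


/-- **The §9.2 base exists** (as a subfield of `ℂ`): for `τ, ε ∈ ℂ` transcendental over `ℚ`
there is a finitely generated partial exponential field with standard kernel
(`Literature.NumberTheory.Transcendental.IsStdKernelPartialExpField`) `K = ℚ(D ∪ θ(D)) ⊆ ℂ`,
`D = span_ℚ(1, τ)`, `θ = exp ∘ g` with `θ 1 = ε`, kernel `τℤ` — Bays–Kirby's
`K = ℚ^{ab}(τ, (ε_m))` with `Γ(K)` the graph of `τ/m ↦ ω_m`, `1/m ↦ ε_m`. The embedding
`ι₀ : K → ℂ` is the inclusion. [cite: BaysKirby2018ANT, §9.2] -/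
theorem exists_isStdKernelPartialExpField {τ ε : ℂ} (hτ : Transcendental ℚ τ)
    (hε : Transcendental ℚ ε) :
    ∃ (K : Type) (_ : Field K) (_ : CharZero K) (D : Submodule ℚ K) (θ : K → K) (t : K)
      (ι₀ : K →+* ℂ), IsStdKernelPartialExpField K D θ t ∧ Function.Injective ι₀ ∧
      (1 : K) ∈ D ∧ ι₀ t = τ ∧ ι₀ (θ 1) = ε := by
  classical
  have hε0 : ε ≠ 0 := fun h => hε (h ▸ isAlgebraic_zero)
  obtain ⟨g, hg1, hgτ⟩ := exists_linearMap_apply_one_apply_tau hτ (Complex.log ε)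
  have hexp1 : Complex.exp (g 1) = ε := by rw [hg1, Complex.exp_log hε0]
  -- the domain in `ℂ`, the partial exponential, the generated subfield
  set Dc : Submodule ℚ ℂ := Submodule.span ℚ ({1, τ} : Set ℂ) with hDc
  set θc : ℂ → ℂ := fun z => Complex.exp (g z) with hθc
  set K : Subfield ℂ := Subfield.closure ((Dc : Set ℂ) ∪ θc '' Dc) with hK
  have hDK : (Dc : Set ℂ) ⊆ K := fun x hx => Subfield.subset_closure (Or.inl hx)
  have hθK : ∀ x ∈ Dc, θc x ∈ K := fun x hx => Subfield.subset_closure (Or.inr ⟨x, hx, rfl⟩)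
  have h1D : (1 : ℂ) ∈ Dc := Submodule.subset_span (Or.inl rfl)
  have hτD : τ ∈ Dc := Submodule.subset_span (Or.inr rfl)
  let t : K := ⟨τ, hDK hτD⟩
  let D : Submodule ℚ K := Submodule.span ℚ ({1, t} : Set K)
  let θ : K → K := fun x => if hx : (x : ℂ) ∈ Dc then ⟨θc x, hθK x hx⟩ else 1
  have hcoe_smul : ∀ (a : ℚ) (x : K), ((a • x : K) : ℂ) = a • (x : ℂ) := by
    intro a x
    rw [Rat.smul_def, Rat.smul_def, Subfield.coe_mul, SubfieldClass.coe_ratCast]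
  have hcoe_zsmul : ∀ (k : ℤ) (x : K), ((k • x : K) : ℂ) = k • (x : ℂ) :=
    fun k x => map_zsmul K.subtype k x
  -- membership in `D` is membership in `Dc`
  have hmemD : ∀ x : K, x ∈ D ↔ (x : ℂ) ∈ Dc := by
    intro x
    rw [Submodule.mem_span_pair, Submodule.mem_span_pair]
    constructor
    · rintro ⟨a, c, rfl⟩
      exact ⟨a, c, by rw [Subfield.coe_add, hcoe_smul, hcoe_smul]; rfl⟩
    · rintro ⟨a, c, hac⟩
      refine ⟨a, c, Subtype.ext ?_⟩
      rw [Subfield.coe_add, hcoe_smul, hcoe_smul, ← hac]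
      rfl
  have hθ_of_mem : ∀ {x : K} (hx : (x : ℂ) ∈ Dc), θ x = ⟨θc x, hθK x hx⟩ := fun hx => dif_pos hx
  refine ⟨K, inferInstance, inferInstance, D, θ, t, K.subtype, ?_, Subtype.val_injective,
    Submodule.subset_span (Or.inl rfl), rfl, ?_⟩
  · refine
      { finiteDimensional := Module.Finite.span_of_finite ℚ (Set.toFinite _)
        map_add := ?_
        map_ne_zero := ?_
        mem := Submodule.subset_span (Or.inr rfl)
        transcendental := ?_
        map_eq_one_iff := ?_
        closure_eq_top := ?_ }
    · intro x y hx hy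
      rw [hmemD] at hx hy
      have hxy : ((x + y : K) : ℂ) ∈ Dc := by rw [Subfield.coe_add]; exact Dc.add_mem hx hy
      rw [hθ_of_mem hxy, hθ_of_mem hx, hθ_of_mem hy]
      refine Subtype.ext ?_
      simp only [hθc, Subfield.coe_add, map_add, Complex.exp_add, Subfield.coe_mul]
    · intro x hx
      rw [hmemD] at hx
      rw [hθ_of_mem hx, Ne, Subtype.ext_iff]
      exact Complex.exp_ne_zero _
    · intro halg
      exact hτ (halg.algHom K.subtype.toRatAlgHom)
    · intro x hx
      rw [hmemD] at hx
      rw [hθ_of_mem hx, Subtype.ext_iff, Subfield.coe_one]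
      change Complex.exp (g x) = 1 ↔ _
      rw [exp_linearMap_eq_one_iff hε hexp1 hgτ hx, AddSubgroup.mem_zmultiples_iff,
        AddSubgroup.mem_zmultiples_iff]
      constructor
      · rintro ⟨k, hk⟩
        exact ⟨k, Subtype.ext (by rw [hcoe_zsmul]; exact hk)⟩
      · rintro ⟨k, rfl⟩
        exact ⟨k, by rw [hcoe_zsmul]⟩
    · -- `K` is generated by `D ∪ θ(D)`: push the closure in `K` forward to `ℂ`
      rw [eq_top_iff]
      intro x _
      set S : Subfield K := Subfield.closure ((D : Set K) ∪ θ '' D) with hS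
      have hle : K ≤ S.map K.subtype := by
        refine Subfield.closure_le.mpr ?_
        rintro c (hc | ⟨d, hd, rfl⟩)
        · refine ⟨⟨c, hDK hc⟩, Subfield.subset_closure (Or.inl ?_), rfl⟩
          exact (hmemD _).mpr hc
        · refine ⟨θ ⟨d, hDK hd⟩, Subfield.subset_closure (Or.inr ⟨⟨d, hDK hd⟩, ?_, rfl⟩), ?_⟩
          · exact (hmemD _).mpr hd
          · change ((θ ⟨d, hDK hd⟩ : K) : ℂ) = θc d
            rw [hθ_of_mem (x := ⟨d, hDK hd⟩) hd]
      obtain ⟨y, hy, hyx⟩ := hle x.2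
      rwa [← Subtype.val_injective hyx]
  · change ((θ 1 : K) : ℂ) = ε
    have h1 : ((1 : K) : ℂ) ∈ Dc := by rw [Subfield.coe_one]; exact h1D
    rw [hθ_of_mem h1]
    change Complex.exp (g ((1 : K) : ℂ)) = ε
    rw [Subfield.coe_one, hexp1]


/-! ### The §9.2 base for an admissible `P` -/

/-- There is a complex number transcendental over `ℚ` (Liouville's constant `Σ 2^{-n!}`,
Mathlib's `transcendental_liouvilleNumber`, transported from `ℤ` to `ℚ` and from `ℝ` to `ℂ`).
[folklore] -/
theorem exists_transcendental_complex : ∃ τ : ℂ, Transcendental ℚ τ := by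
  refine ⟨((liouvilleNumber (2 : ℕ) : ℝ) : ℂ), ?_⟩
  have h : Transcendental ℤ (liouvilleNumber (2 : ℕ)) := transcendental_liouvilleNumber le_rfl
  have hQ : Transcendental ℚ (liouvilleNumber (2 : ℕ)) := fun halg =>
    h ((IsFractionRing.isAlgebraic_iff ℤ ℚ ℝ).mpr halg)
  exact (transcendental_algebraMap_iff (algebraMap ℝ ℂ).injective).mpr hQ

/-- **The base of `𝔹_P`** (Bays–Kirby §9.2, first paragraph): for an admissible `P ∈ ℤ[x, y]`
(irreducible, of positive degree in each variable) there is a finitely generated partial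
exponential field `K` with standard kernel `τℤ` whose domain `D` contains `1`, with
`ε := θ 1` transcendental and `P(ε, τ) = 0` — i.e. `(ε, τ)` a generic zero of `P` and `Γ(K)` the
graph of `τ/m ↦ ω_m`, `1/m ↦ ε_m` on `span_ℚ(τ, 1)`. (`τ`: any transcendental; `ε`: a root of
`P(x, τ)`, transcendental by `PlaneCurve.transcendental_of_aeval_eq_zero'`.)
[cite: BaysKirby2018ANT, §9.2] -/
theorem exists_base_of_isAdmissibleRelation {P : MvPolynomial (Fin 2) ℤ}
    (hP : IsAdmissibleRelation P) :
    ∃ (K : Type) (_ : Field K) (_ : CharZero K) (D : Submodule ℚ K) (θ : K → K) (t : K),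
      IsStdKernelPartialExpField K D θ t ∧ (1 : K) ∈ D ∧ Transcendental ℚ (θ 1) ∧
      MvPolynomial.aeval ![θ 1, t] P = 0 := by
  obtain ⟨hirr, hd0, hd1⟩ := hP
  obtain ⟨τ, hτ⟩ := exists_transcendental_complex
  obtain ⟨ε, hε⟩ := PlaneCurve.exists_aeval_eq_zero_of_degreeOf_pos hd0 hτ
  have hεt : Transcendental ℚ ε := PlaneCurve.transcendental_of_aeval_eq_zero' hirr hd1 hτ hε
  obtain ⟨K, _, _, D, θ, t, ι₀, hbase, hinj, h1, ht, hθ1⟩ :=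
    exists_isStdKernelPartialExpField hτ hεt
  refine ⟨K, inferInstance, inferInstance, D, θ, t, hbase, h1, ?_, ?_⟩
  · intro halg
    apply hεt
    have h' : IsAlgebraic ℚ (ι₀ (θ 1)) := halg.algHom ι₀.toRatAlgHom
    rwa [hθ1] at h'
  · apply hinj
    have key : ι₀ (MvPolynomial.aeval ![θ 1, t] P) = MvPolynomial.aeval ![ε, τ] P := by
      have h := MvPolynomial.comp_aeval_apply ι₀.toIntAlgHom P (f := ![θ 1, t])
      have hv : (fun i => ι₀.toIntAlgHom (![θ 1, t] i)) = ![ε, τ] := by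
        funext i
        fin_cases i
        · simpa [RingHom.toIntAlgHom_apply] using hθ1
        · simpa [RingHom.toIntAlgHom_apply] using ht
      rw [hv] at h
      exact h
    rw [key, hε, map_zero]

/-! ### Assembly: `𝔹_P` from a soft Zilber field over the §9.2 base

The hypothesis `h` below is Bays–Kirby's construction theorem in the form the assembly uses (see
the module docstring, part 2): over every finitely generated partial exponential field with
standard kernel `(K, D, θ, τ)` there is a soft Zilber field `F` (`IsSoftZilberField F`) with a
field embedding `ι : K →+* F` along which `exp` extends `θ` on `D` and `ker exp = ι(τ)ℤ`
(Thm 1.7 with Thm 8.2 (1), (2), (4), (5) for `𝕄(F_base)`, §9.2: "a quasiminimal exponential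
field `𝕄(F_base)` of size continuum"). It is a hypothesis, not a named fact (D-0026). -/

/-- **Bays–Kirby's `𝔹_P` from a soft Zilber field over the §9.2 base** (§9.2 with Thm 1.7 /
Thm 8.2): if over every finitely generated partial exponential field with standard kernel there
is a soft Zilber field extending it with the same kernel (hypothesis `h`, the construction of
`𝕄(F_base)`, §§3–8 of the paper — not formalised), then for every admissible `P` the model `F`
over the §9.2 base `K` (`exists_base_of_isAdmissibleRelation`) witnesses
`baysKirby2018_modelsWithoutSchanuel P`: `#F = 𝔠`; ELA; `ker exp = ι(τ)ℤ` with `ι τ`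
transcendental; `exp 1 = ι (θ 1) = ι ε` transcendental and `P(exp 1, ι τ) = ι (P(ε, τ)) = 0`;
Kirby's scheme; the countable closure property; quasiminimality.
[cite: BaysKirby2018ANT, §9.2, Thm 1.7, Thm 8.2] -/
theorem baysKirby2018_modelsWithoutSchanuel_of_softModels
    (h : ∀ (K : Type) [Field K] [CharZero K] (D : Submodule ℚ K) (θ : K → K) (τ : K),
      IsStdKernelPartialExpField K D θ τ →
      ∃ (F : Type) (_ : Field F) (_ : CharZero F) (_ : ExponentialRing F) (ι : K →+* F),
        IsSoftZilberField F ∧ (∀ x ∈ D, exp (ι x) = ι (θ x)) ∧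
          expKernel F = AddSubgroup.zmultiples (ι τ)) :
    baysKirby2018_modelsWithoutSchanuel := by
  intro P hP
  obtain ⟨K, _, _, D, θ, t, hbase, h1, hε, hPK⟩ := exists_base_of_isAdmissibleRelation hP
  obtain ⟨F, _, _, _, ι, ⟨hcard, hac, hsurj, -, hlin, hccp, hqm⟩, hext, hker⟩ := h K D θ t hbase
  have hexp1 : exp (1 : F) = ι (θ 1) := by
    rw [show (1 : F) = ι 1 from (map_one ι).symm]
    exact hext 1 h1
  refine ⟨F, inferInstance, inferInstance, inferInstance, hcard, hac, hsurj, ⟨ι t, ?_, hker, ?_, ?_⟩,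
    hlin, hccp, hqm⟩
  · intro halg
    exact hbase.transcendental
      ((isAlgebraic_algHom_iff ι.toRatAlgHom (fun a b hab => ι.injective hab)).mp halg)
  · rw [hexp1]
    intro halg
    exact hε ((isAlgebraic_algHom_iff ι.toRatAlgHom (fun a b hab => ι.injective hab)).mp halg)
  · have key : ι (MvPolynomial.aeval ![θ 1, t] P) = MvPolynomial.aeval ![exp (1 : F), ι t] P := by
      have h := MvPolynomial.comp_aeval_apply ι.toIntAlgHom P (f := ![θ 1, t])
      have hv : (fun i => ι.toIntAlgHom (![θ 1, t] i)) = ![exp (1 : F), ι t] := by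
        funext i
        fin_cases i
        · simpa [RingHom.toIntAlgHom_apply] using hexp1.symm
        · simp [RingHom.toIntAlgHom_apply]
      rw [hv] at h
      exact h
    rw [← key, hPK, map_zero]

/-- The refutation of the soft technique class from the construction over standard-kernel bases:
"soft methods which ignore transcendental number theory and analytic considerations cannot hope
to work". [cite: BaysKirby2018ANT, §9.2] -/
theorem not_softDerivationOfSchanuel_of_softModels
    (h : ∀ (K : Type) [Field K] [CharZero K] (D : Submodule ℚ K) (θ : K → K) (τ : K),
      IsStdKernelPartialExpField K D θ τ →
      ∃ (F : Type) (_ : Field F) (_ : CharZero F) (_ : ExponentialRing F) (ι : K →+* F),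
        IsSoftZilberField F ∧ (∀ x ∈ D, exp (ι x) = ι (θ x)) ∧
          expKernel F = AddSubgroup.zmultiples (ι τ)) :
    ¬ SoftDerivationOfSchanuel :=
  not_softDerivationOfSchanuel (baysKirby2018_modelsWithoutSchanuel_of_softModels h)

/-- **The whole barrier from the construction over standard-kernel bases** (Bays–Kirby Thm 1.7 /
Thm 8.2 over the §9.2 base): the counter-models `𝔹_P` exist for every admissible `P`
(`baysKirby2018_modelsWithoutSchanuel`) and the soft technique class is refuted
(`¬ SoftDerivationOfSchanuel`). Stated as this explicit conjunction (not through the catalogue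
declaration `AxiomsDoNotForceSchanuel`, whose body it must not depend on).
[cite: BaysKirby2018ANT, §9.2, Thm 1.7, Thm 8.2] -/
theorem axiomsDoNotForceSchanuel_of_softModels
    (h : ∀ (K : Type) [Field K] [CharZero K] (D : Submodule ℚ K) (θ : K → K) (τ : K),
      IsStdKernelPartialExpField K D θ τ →
      ∃ (F : Type) (_ : Field F) (_ : CharZero F) (_ : ExponentialRing F) (ι : K →+* F),
        IsSoftZilberField F ∧ (∀ x ∈ D, exp (ι x) = ι (θ x)) ∧
          expKernel F = AddSubgroup.zmultiples (ι τ)) :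
    baysKirby2018_modelsWithoutSchanuel ∧ ¬ SoftDerivationOfSchanuel :=
  ⟨baysKirby2018_modelsWithoutSchanuel_of_softModels h,
    not_softDerivationOfSchanuel_of_softModels h⟩

end Literature.Barriers.Schanuel

end
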